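import Summits.QuantumFields.YangMills.Theorems.FluctuationComparisonRegPrIntLS2BetaRelFlapOfFeeders
import Summits.QuantumFields.YangMills.Theorems.FluctuationComparisonRegPrIntLS2BetaChartLetterAlongTowers
import Summits.QuantumFields.YangMills.Theorems.FluctuationComparisonRegPrIntLS2BetaWhitneyHatLiftCurvatureRelativePlaq
import HarnessLib

/-!
# S2β · the (D-stage) REL-TEL road — THE PREFIX ASSEMBLY: ✓p824471's letter-with-feedback `HLW(G)` (hence (D-stage) by ✓`dStage_of_feedbackLetter`) ⟸
# TWO displayed prefix letters, KEYREL(G) (the relative key-lemma tower in door currency — px10's lane) and FLAPREL(G) (the two-tower flap letter in door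
# currency — px21's C4 at the towers), for any guard `G` implying the explicit small-bond condition `arc(V e) ≤ 1∕128`; (L♭), (F3)-rel, (R1), the sup budgets and
# the W-smallness are DISCHARGED INSIDE (✓`exists_gamma_chartLetter_128`, ✓p826241, ✓p820752, ✓`exists_gamma_supBudget_128`, ✓`G_le_of_bkgPriced`'s role is
# played by KEYREL's `δ`-clause)

Cell `ym3-torus` (rung R3 = continuum `SU(2)` Yang–Mills on T³ — NOT d = 4, NOT infinite volume, NOT a mass gap, NOT Clay).  Width seat «width 12» `ym3-torus-px12`
(gen 24), FREE px helper on crux `stmt-QuantumFields-20520`; `--kind proof --supports … --as helper`, count-neutral, DEFINITION-FREE (0 `def`∕`instance`∕`notation`∕`sorry`).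

THE TWO LETTERS (both in ✓p824471's `HLW` prefix, a target `δ > 0` quantified BEFORE `γ₁` for their BACKGROUND-priced parts — UV3-NODE §84.8):
`KEYREL(G)` = `… ∃ X₁ ≥ 1, ∀ δ > 0, ∃ γ₁, … ∃ ηA qd qU ≥ 0, [A_t ≤ X₁((√L)^t·S + Σ_{s<t}(√L)^{t−1−s}ηA s)] ∧ [ηA s ≤ qd s·B_s + qU s·B_{s+1}] ∧ Σ_jG_j(qd) ≤ δ ∧
Σ_jG_j(qU) ≤ δ` (px10's lane: FILE 11 ✓p825006 at `(g_0•U, g₀_0•U₀)` via (T3), junk θ₀-priced so that ✓`G_le_of_bkgPriced` gives the `δ`-clause);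
`FLAPREL(G)` = `… ∃ a₁ > 0, a₂ Z ≥ 0, ∀ δ > 0, ∃ γ₁, … ∃ η ζ ≥ 0, [flap_j ≤ a₁A_j + a₂A^V_j + η_jB_j + ζ_jB^V_j] ∧ Σ_jη_j ≤ δ ∧ Σ_jζ_j ≤ Z` (px21 C4 ✓p825893
with the BACKGROUND tower as «tower 1»).  OUTPUT ★★★`feedbackLetterPrefix_of_letters (Gx) (hGx : Gx ⟹ arc ≤ 1∕128) (hKEY) (hFLAP) : HLW(Gx)`, `E = E′ + E_e`,
`C = X₁(a₁ + a₂C_F√L)`, `C_F = 2√c`, `c = (L⁻¹)⁴L³`, `φ_j = √c√(768·2)(s_{j+1}+s̃_{j+1})`, `δ = min(1, 1∕(2e^Eκ))`; then (D-stage)(Gx) = ✓`dStage_of_feedbackLetter Gx` ∘ it.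
‼ `Gx ⟹ arc(V e) ≤ 1∕128` is NOT suppliable on the strata at coarse `J` (toron obstruction, §84.8∕§86.5, px8 g24); this is the road UNDER the guard.
HONEST SCOPE.  Prefix plumbing by name; KEYREL and FLAPREL are HYPOTHESES (their suppliers: px10 FILE 12″, px21 C4 instantiated); nothing of Bałaban's analysis is
asserted; (D-ax)∕(D♮), (F♮), GAP♯∘ (`stub_uniformFibreGapOrbit`), S2β, the five registered stubs (0∕5), crux 20520 and `YM3TorusSU2` are NOT proved; no registered
stub is closed; the Yang–Mills mass gap is NOT proved.
References: T. Bałaban, CMP **99** (1985) 75–102 [Balaban1985RegularSpaces] ((1.29) p.81, Lemma 1 p.79); CMP **98** (1985) 17–51 [Balaban1985Averaging] ((19)–(21)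
pp.21–22); CMP **102** (1985) 277–309 [Balaban1985Variational] (Thm 1 (8)–(10) p.279, (4) p.278).
-/

set_option autoImplicit false

noncomputable section

namespace Summit.QuantumFields.YangMills.Theorems.FluctuationComparisonRegPrIntLS2BetaStageFeedersAssembly

open Finset
open scoped Real
open Literature.MathematicalPhysics.QuantumLattice (su2Quat)
open Literature.MathematicalPhysics.QuantumFieldTheory.Balaban1983to89
open T4Continuum T3ContinuumYM3Torus T3UnitScaleTilt T3TiltDescent T3LevelShift BlockAveraging
open T4CubeChartGnomonic (SU2)
open T4HaarSU2ExpChart (expPoint)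
open T4ExpWindowSmallField (logVec)
open T3UnitLawDensityEML (ℰp)
open T3ConstrainedMinimiser (fibre)
open T3PrintedRegularMinimiser (minActionRegPr)
open B10Eq27TorusAxialLog (rel axialT)
open Summit.QuantumFields.YangMills.Theorems.FluctuationComparisonRegPrIntLS2BetaRelFlapOfFeeders (feedbackLetter_of_feeders)
open Summit.QuantumFields.YangMills.Theorems.FluctuationComparisonRegPrIntLS2BetaRelFlapOfFeedersAlgebra (e_budget_le smallness_le)
open Summit.QuantumFields.YangMills.Theorems.FluctuationComparisonRegPrIntLS2BetaChartLetterAlongTowers (exists_gamma_chartLetter_128)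
open Summit.QuantumFields.YangMills.Theorems.FluctuationComparisonRegPrIntLS2BetaRelativeTowerSupBudget128 (exists_gamma_supBudget_128)
open Summit.QuantumFields.YangMills.Theorems.FluctuationComparisonRegPrIntLS2BetaWhitneyHatLiftCurvatureRelativePlaq (sqrt_sum_plaq_dist1_rel_lift_le)
open Summit.QuantumFields.YangMills.Theorems.FluctuationComparisonRegPrIntLS2BetaWhitneyHatLiftRelative (sum_dist1_sq_lift_mul_inv_le)

set_option maxHeartbeats 400000 in
/-- ★★★ **THE PREFIX ASSEMBLY**: ✓p824471's `HLW(Gx)` from the two displayed letters `KEYREL(Gx)`, `FLAPREL(Gx)` for any guard `Gx` implying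
`arc(V e) ≤ 1∕128`; (L♭), (F3)-rel, (R1), the sup budgets and the W-smallness discharged inside. [cite: Balaban1985RegularSpaces, (1.29) p.81, Lemma 1 p.79;
Balaban1985Averaging, (19)-(21) pp.21-22] -/
theorem feedbackLetterPrefix_of_letters
    (Gx : (F : T3Family) → (J : ℕ) → GaugeField (F.P J) 0 (Matrix.specialUnitaryGroup (Fin 2) ℂ) → Prop)
    (hGx : ∀ (F : T3Family) (J : ℕ) (V : GaugeField (F.P J) 0 (Matrix.specialUnitaryGroup (Fin 2) ℂ)), Gx F J V →
      ∀ e, ‖logVec (su2Quat (V e))‖ ≤ 1 / 128)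
    (hKEY : ∀ (L : ℕ), ∃ c₀ : ℝ, 0 < c₀ ∧ c₀ ≤ 1 ∧ ∀ (cw : ℝ), 0 < cw → cw ≤ c₀ → ∃ pS : ℝ, ∀ (b₀ p₀ : ℝ), 0 < b₀ → pS ≤ p₀ → 0 < p₀ → ∃ ε₁ : ℝ, 0 < ε₁ ∧ ∀ (ε₀ : ℝ), 0 < ε₀ → ε₀ ≤ ε₁ →
      ∃ X₁ : ℝ, 1 ≤ X₁ ∧ ∀ (δ : ℝ), 0 < δ → ∃ γ₁ : ℝ, 0 < γ₁ ∧ ∀ (F : T3Family) (γ : ℝ), F.L = L → 0 < γ → γ ≤ γ₁ →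
        ∀ (J K : ℕ) (hJK : J ≤ K) (V : GaugeField (F.P J) 0 (Matrix.specialUnitaryGroup (Fin 2) ℂ)), PlaqSmall (θBal F.L γ (cw * b₀) p₀ J) V →
          Gx F J V →
          ∀ U₀ ∈ {U' : GaugeField (F.P K) 0 (Matrix.specialUnitaryGroup (Fin 2) ℂ) | U' ∈ fibre F ℰp J K hJK V ∧ U' ∈ histGood F ℰp (θBal F.L γ b₀ p₀) K J ∧
              wilsonAction4 U' = minActionRegPr F J K hJK ε₀ V},
          ∀ U ∈ fibre F ℰp J K hJK V, U ∈ histGood F ℰp (θBal F.L γ b₀ p₀) K J →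
          ∀ (wt : (j : ℕ) → PBond (F.P K) j → PBond (F.P K) (j + 1) → ℝ)
            (lift : (j : ℕ) → GaugeField (F.P K) (j + 1) SU2 → GaugeField (F.P K) j SU2),
            (∀ j b e, wt j b e = if e.dir = b.dir ∧ (b.src b.dir - emb e.src b.dir).val < (F.P K).L then
                ∏ ν ∈ Finset.univ.erase b.dir, max 0 (1 - ((rel (emb e.src) b.src ν).natAbs : ℝ) / (F.P K).L) else 0) →
            (∀ j X b, lift j X b = expPoint (∑ e, wt j b e • ((((F.P K).L : ℕ) : ℝ)⁻¹ • logVec (su2Quat (X e))))) →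
          ∀ g g₀ : (j : ℕ) → Site (F.P K) j → SU2,
            (∀ j, j < K - J → ∀ x, g j x =
              (axialT (lift j (GaugeField.gaugeAct (g (j + 1)) (Averaging.iter (fun k => blockAvg (P := F.P K) (j := k) ℰp) (j + 1) U)))
                  (emb (blockOf x)) x)⁻¹ *
                g (j + 1) (blockOf x) * axialT (Averaging.iter (fun k => blockAvg (P := F.P K) (j := k) ℰp) j U) (emb (blockOf x)) x) →
            (∀ j, K - J ≤ j → ∀ y, g j y = 1) →
            (∀ j, j < K - J → ∀ y : Site (F.P K) (j + 1), g j (emb y) = g (j + 1) y) →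
            (∀ X : GaugeField (F.P K) 0 SU2, ∀ j, j ≤ K - J →
              Averaging.iter (fun k => blockAvg (P := F.P K) (j := k) ℰp) j (GaugeField.gaugeAct (g 0) X) =
                GaugeField.gaugeAct (g j) (Averaging.iter (fun k => blockAvg (P := F.P K) (j := k) ℰp) j X)) →
            (∀ j, j < K - J → ∀ x,
              axialT (GaugeField.gaugeAct (g j) (Averaging.iter (fun k => blockAvg (P := F.P K) (j := k) ℰp) j U)) (emb (blockOf x)) x =
                axialT (lift j (GaugeField.gaugeAct (g (j + 1)) (Averaging.iter (fun k => blockAvg (P := F.P K) (j := k) ℰp) (j + 1) U)))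
                  (emb (blockOf x)) x) →
            (∀ j, j < K - J →
              (blockAvg (P := F.P K) (j := j) ℰp).avg (GaugeField.gaugeAct (g j) (Averaging.iter (fun k => blockAvg (P := F.P K) (j := k) ℰp) j U)) =
                GaugeField.gaugeAct (g (j + 1)) (Averaging.iter (fun k => blockAvg (P := F.P K) (j := k) ℰp) (j + 1) U)) →
            (∀ j, j < K - J → ∀ x, g₀ j x =
              (axialT (lift j (GaugeField.gaugeAct (g₀ (j + 1)) (Averaging.iter (fun k => blockAvg (P := F.P K) (j := k) ℰp) (j + 1) U₀)))
                  (emb (blockOf x)) x)⁻¹ *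
                g₀ (j + 1) (blockOf x) * axialT (Averaging.iter (fun k => blockAvg (P := F.P K) (j := k) ℰp) j U₀) (emb (blockOf x)) x) →
            (∀ j, K - J ≤ j → ∀ y, g₀ j y = 1) →
            (∀ j, j < K - J → ∀ y : Site (F.P K) (j + 1), g₀ j (emb y) = g₀ (j + 1) y) →
            (∀ X : GaugeField (F.P K) 0 SU2, ∀ j, j ≤ K - J →
              Averaging.iter (fun k => blockAvg (P := F.P K) (j := k) ℰp) j (GaugeField.gaugeAct (g₀ 0) X) =
                GaugeField.gaugeAct (g₀ j) (Averaging.iter (fun k => blockAvg (P := F.P K) (j := k) ℰp) j X)) →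
            (∀ j, j < K - J → ∀ x,
              axialT (GaugeField.gaugeAct (g₀ j) (Averaging.iter (fun k => blockAvg (P := F.P K) (j := k) ℰp) j U₀)) (emb (blockOf x)) x =
                axialT (lift j (GaugeField.gaugeAct (g₀ (j + 1)) (Averaging.iter (fun k => blockAvg (P := F.P K) (j := k) ℰp) (j + 1) U₀)))
                  (emb (blockOf x)) x) →
            (∀ j, j < K - J →
              (blockAvg (P := F.P K) (j := j) ℰp).avg (GaugeField.gaugeAct (g₀ j) (Averaging.iter (fun k => blockAvg (P := F.P K) (j := k) ℰp) j U₀)) =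
                GaugeField.gaugeAct (g₀ (j + 1)) (Averaging.iter (fun k => blockAvg (P := F.P K) (j := k) ℰp) (j + 1) U₀)) →
            ∃ (ηA qd qU : ℕ → ℝ), (∀ s, 0 ≤ qd s) ∧ (∀ s, 0 ≤ qU s) ∧
              (∀ t, t ≤ K - J →
                √(∑ q, dist1 ((GaugeField.plaqHol (GaugeField.gaugeAct (g₀ t) (Averaging.iter (fun k => blockAvg (P := F.P K) (j := k) ℰp) t U₀)) q)⁻¹ *
                  GaugeField.plaqHol (GaugeField.gaugeAct (g t) (Averaging.iter (fun k => blockAvg (P := F.P K) (j := k) ℰp) t U)) q) ^ 2) ≤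
                  X₁ * (Real.sqrt (F.L : ℝ) ^ t * √(∑ p, dist1 ((GaugeField.plaqHol (GaugeField.gaugeAct (g₀ 0) U₀) p)⁻¹ * GaugeField.plaqHol (GaugeField.gaugeAct (g 0) U) p) ^ 2) +
                    ∑ s ∈ range t, Real.sqrt (F.L : ℝ) ^ (t - 1 - s) * ηA s)) ∧
              (∀ s, s < K - J → ηA s ≤ qd s * √(∑ b, dist1 (GaugeField.gaugeAct (g s) (Averaging.iter (fun k => blockAvg (P := F.P K) (j := k) ℰp) s U) b *
                  (GaugeField.gaugeAct (g₀ s) (Averaging.iter (fun k => blockAvg (P := F.P K) (j := k) ℰp) s U₀) b)⁻¹) ^ 2) +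
                qU s * √(∑ b, dist1 (GaugeField.gaugeAct (g (s + 1)) (Averaging.iter (fun k => blockAvg (P := F.P K) (j := k) ℰp) (s + 1) U) b *
                  (GaugeField.gaugeAct (g₀ (s + 1)) (Averaging.iter (fun k => blockAvg (P := F.P K) (j := k) ℰp) (s + 1) U₀) b)⁻¹) ^ 2)) ∧
              ∑ j ∈ range (K - J), ∑ u ∈ range (j + 1), (F.L : ℝ) ^ (j - u) * qd u ≤ δ ∧
              ∑ j ∈ range (K - J), ∑ u ∈ range (j + 1), (F.L : ℝ) ^ (j - u) * qU u ≤ δ)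
    (hFLAP : ∀ (L : ℕ), ∃ c₀ : ℝ, 0 < c₀ ∧ c₀ ≤ 1 ∧ ∀ (cw : ℝ), 0 < cw → cw ≤ c₀ → ∃ pS : ℝ, ∀ (b₀ p₀ : ℝ), 0 < b₀ → pS ≤ p₀ → 0 < p₀ → ∃ ε₁ : ℝ, 0 < ε₁ ∧ ∀ (ε₀ : ℝ), 0 < ε₀ → ε₀ ≤ ε₁ →
      ∃ a₁ a₂ Z : ℝ, 0 < a₁ ∧ 0 ≤ a₂ ∧ 0 ≤ Z ∧ ∀ (δ : ℝ), 0 < δ → ∃ γ₁ : ℝ, 0 < γ₁ ∧ ∀ (F : T3Family) (γ : ℝ), F.L = L → 0 < γ → γ ≤ γ₁ →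
        ∀ (J K : ℕ) (hJK : J ≤ K) (V : GaugeField (F.P J) 0 (Matrix.specialUnitaryGroup (Fin 2) ℂ)), PlaqSmall (θBal F.L γ (cw * b₀) p₀ J) V →
          Gx F J V →
          ∀ U₀ ∈ {U' : GaugeField (F.P K) 0 (Matrix.specialUnitaryGroup (Fin 2) ℂ) | U' ∈ fibre F ℰp J K hJK V ∧ U' ∈ histGood F ℰp (θBal F.L γ b₀ p₀) K J ∧
              wilsonAction4 U' = minActionRegPr F J K hJK ε₀ V},
          ∀ U ∈ fibre F ℰp J K hJK V, U ∈ histGood F ℰp (θBal F.L γ b₀ p₀) K J →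
          ∀ (wt : (j : ℕ) → PBond (F.P K) j → PBond (F.P K) (j + 1) → ℝ)
            (lift : (j : ℕ) → GaugeField (F.P K) (j + 1) SU2 → GaugeField (F.P K) j SU2),
            (∀ j b e, wt j b e = if e.dir = b.dir ∧ (b.src b.dir - emb e.src b.dir).val < (F.P K).L then
                ∏ ν ∈ Finset.univ.erase b.dir, max 0 (1 - ((rel (emb e.src) b.src ν).natAbs : ℝ) / (F.P K).L) else 0) →
            (∀ j X b, lift j X b = expPoint (∑ e, wt j b e • ((((F.P K).L : ℕ) : ℝ)⁻¹ • logVec (su2Quat (X e))))) →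
          ∀ g g₀ : (j : ℕ) → Site (F.P K) j → SU2,
            (∀ j, j < K - J → ∀ x, g j x =
              (axialT (lift j (GaugeField.gaugeAct (g (j + 1)) (Averaging.iter (fun k => blockAvg (P := F.P K) (j := k) ℰp) (j + 1) U)))
                  (emb (blockOf x)) x)⁻¹ *
                g (j + 1) (blockOf x) * axialT (Averaging.iter (fun k => blockAvg (P := F.P K) (j := k) ℰp) j U) (emb (blockOf x)) x) →
            (∀ j, K - J ≤ j → ∀ y, g j y = 1) →
            (∀ j, j < K - J → ∀ y : Site (F.P K) (j + 1), g j (emb y) = g (j + 1) y) →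
            (∀ X : GaugeField (F.P K) 0 SU2, ∀ j, j ≤ K - J →
              Averaging.iter (fun k => blockAvg (P := F.P K) (j := k) ℰp) j (GaugeField.gaugeAct (g 0) X) =
                GaugeField.gaugeAct (g j) (Averaging.iter (fun k => blockAvg (P := F.P K) (j := k) ℰp) j X)) →
            (∀ j, j < K - J → ∀ x,
              axialT (GaugeField.gaugeAct (g j) (Averaging.iter (fun k => blockAvg (P := F.P K) (j := k) ℰp) j U)) (emb (blockOf x)) x =
                axialT (lift j (GaugeField.gaugeAct (g (j + 1)) (Averaging.iter (fun k => blockAvg (P := F.P K) (j := k) ℰp) (j + 1) U)))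
                  (emb (blockOf x)) x) →
            (∀ j, j < K - J →
              (blockAvg (P := F.P K) (j := j) ℰp).avg (GaugeField.gaugeAct (g j) (Averaging.iter (fun k => blockAvg (P := F.P K) (j := k) ℰp) j U)) =
                GaugeField.gaugeAct (g (j + 1)) (Averaging.iter (fun k => blockAvg (P := F.P K) (j := k) ℰp) (j + 1) U)) →
            (∀ j, j < K - J → ∀ x, g₀ j x =
              (axialT (lift j (GaugeField.gaugeAct (g₀ (j + 1)) (Averaging.iter (fun k => blockAvg (P := F.P K) (j := k) ℰp) (j + 1) U₀)))
                  (emb (blockOf x)) x)⁻¹ *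
                g₀ (j + 1) (blockOf x) * axialT (Averaging.iter (fun k => blockAvg (P := F.P K) (j := k) ℰp) j U₀) (emb (blockOf x)) x) →
            (∀ j, K - J ≤ j → ∀ y, g₀ j y = 1) →
            (∀ j, j < K - J → ∀ y : Site (F.P K) (j + 1), g₀ j (emb y) = g₀ (j + 1) y) →
            (∀ X : GaugeField (F.P K) 0 SU2, ∀ j, j ≤ K - J →
              Averaging.iter (fun k => blockAvg (P := F.P K) (j := k) ℰp) j (GaugeField.gaugeAct (g₀ 0) X) =
                GaugeField.gaugeAct (g₀ j) (Averaging.iter (fun k => blockAvg (P := F.P K) (j := k) ℰp) j X)) →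
            (∀ j, j < K - J → ∀ x,
              axialT (GaugeField.gaugeAct (g₀ j) (Averaging.iter (fun k => blockAvg (P := F.P K) (j := k) ℰp) j U₀)) (emb (blockOf x)) x =
                axialT (lift j (GaugeField.gaugeAct (g₀ (j + 1)) (Averaging.iter (fun k => blockAvg (P := F.P K) (j := k) ℰp) (j + 1) U₀)))
                  (emb (blockOf x)) x) →
            (∀ j, j < K - J →
              (blockAvg (P := F.P K) (j := j) ℰp).avg (GaugeField.gaugeAct (g₀ j) (Averaging.iter (fun k => blockAvg (P := F.P K) (j := k) ℰp) j U₀)) =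
                GaugeField.gaugeAct (g₀ (j + 1)) (Averaging.iter (fun k => blockAvg (P := F.P K) (j := k) ℰp) (j + 1) U₀)) →
            ∃ (η ζ : ℕ → ℝ), (∀ j, 0 ≤ η j) ∧ (∀ j, 0 ≤ ζ j) ∧
              (∀ j, j < K - J →
                √(∑ b, dist1 (GaugeField.gaugeAct (g j) (Averaging.iter (fun k => blockAvg (P := F.P K) (j := k) ℰp) j U) b *
                (lift j (GaugeField.gaugeAct (g (j + 1)) (Averaging.iter (fun k => blockAvg (P := F.P K) (j := k) ℰp) (j + 1) U)) b)⁻¹ *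
              (GaugeField.gaugeAct (g₀ j) (Averaging.iter (fun k => blockAvg (P := F.P K) (j := k) ℰp) j U₀) b *
                (lift j (GaugeField.gaugeAct (g₀ (j + 1)) (Averaging.iter (fun k => blockAvg (P := F.P K) (j := k) ℰp) (j + 1) U₀)) b)⁻¹)⁻¹) ^ 2) ≤
                  a₁ * √(∑ q, dist1 ((GaugeField.plaqHol (GaugeField.gaugeAct (g₀ j) (Averaging.iter (fun k => blockAvg (P := F.P K) (j := k) ℰp) j U₀)) q)⁻¹ *
                  GaugeField.plaqHol (GaugeField.gaugeAct (g j) (Averaging.iter (fun k => blockAvg (P := F.P K) (j := k) ℰp) j U)) q) ^ 2) +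
                    a₂ * √(∑ q, dist1 ((GaugeField.plaqHol (lift j (GaugeField.gaugeAct (g₀ (j + 1)) (Averaging.iter (fun k => blockAvg (P := F.P K) (j := k) ℰp) (j + 1) U₀))) q)⁻¹ *
                  GaugeField.plaqHol (lift j (GaugeField.gaugeAct (g (j + 1)) (Averaging.iter (fun k => blockAvg (P := F.P K) (j := k) ℰp) (j + 1) U))) q) ^ 2) +
                    η j * √(∑ b, dist1 (GaugeField.gaugeAct (g j) (Averaging.iter (fun k => blockAvg (P := F.P K) (j := k) ℰp) j U) b *
                  (GaugeField.gaugeAct (g₀ j) (Averaging.iter (fun k => blockAvg (P := F.P K) (j := k) ℰp) j U₀) b)⁻¹) ^ 2) +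
                    ζ j * √(∑ b, dist1 (lift j (GaugeField.gaugeAct (g (j + 1)) (Averaging.iter (fun k => blockAvg (P := F.P K) (j := k) ℰp) (j + 1) U)) b *
                  (lift j (GaugeField.gaugeAct (g₀ (j + 1)) (Averaging.iter (fun k => blockAvg (P := F.P K) (j := k) ℰp) (j + 1) U₀)) b)⁻¹) ^ 2)) ∧
              ∑ j ∈ range (K - J), η j ≤ δ ∧ ∑ j ∈ range (K - J), ζ j ≤ Z) :
    ∀ (L : ℕ), ∃ c₀ : ℝ, 0 < c₀ ∧ c₀ ≤ 1 ∧ ∀ (cw : ℝ), 0 < cw → cw ≤ c₀ → ∃ pS : ℝ, ∀ (b₀ p₀ : ℝ), 0 < b₀ → pS ≤ p₀ → 0 < p₀ → ∃ ε₁ : ℝ, 0 < ε₁ ∧ ∀ (ε₀ : ℝ), 0 < ε₀ → ε₀ ≤ ε₁ →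
      ∃ γ₁ : ℝ, 0 < γ₁ ∧ ∃ E C : ℝ, 0 < C ∧ ∀ (F : T3Family) (γ : ℝ), F.L = L → 0 < γ → γ ≤ γ₁ →
        ∀ (J K : ℕ) (hJK : J ≤ K) (V : GaugeField (F.P J) 0 (Matrix.specialUnitaryGroup (Fin 2) ℂ)), PlaqSmall (θBal F.L γ (cw * b₀) p₀ J) V →
          Gx F J V →
          ∀ U₀ ∈ {U' : GaugeField (F.P K) 0 (Matrix.specialUnitaryGroup (Fin 2) ℂ) | U' ∈ fibre F ℰp J K hJK V ∧ U' ∈ histGood F ℰp (θBal F.L γ b₀ p₀) K J ∧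
              wilsonAction4 U' = minActionRegPr F J K hJK ε₀ V},
          ∀ U ∈ fibre F ℰp J K hJK V, U ∈ histGood F ℰp (θBal F.L γ b₀ p₀) K J →
          ∀ (wt : (j : ℕ) → PBond (F.P K) j → PBond (F.P K) (j + 1) → ℝ)
            (lift : (j : ℕ) → GaugeField (F.P K) (j + 1) SU2 → GaugeField (F.P K) j SU2),
            (∀ j b e, wt j b e = if e.dir = b.dir ∧ (b.src b.dir - emb e.src b.dir).val < (F.P K).L then
                ∏ ν ∈ Finset.univ.erase b.dir, max 0 (1 - ((rel (emb e.src) b.src ν).natAbs : ℝ) / (F.P K).L) else 0) →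
            (∀ j X b, lift j X b = expPoint (∑ e, wt j b e • ((((F.P K).L : ℕ) : ℝ)⁻¹ • logVec (su2Quat (X e))))) →
          ∀ g g₀ : (j : ℕ) → Site (F.P K) j → SU2,
            (∀ j, j < K - J → ∀ x, g j x =
              (axialT (lift j (GaugeField.gaugeAct (g (j + 1)) (Averaging.iter (fun k => blockAvg (P := F.P K) (j := k) ℰp) (j + 1) U)))
                  (emb (blockOf x)) x)⁻¹ *
                g (j + 1) (blockOf x) * axialT (Averaging.iter (fun k => blockAvg (P := F.P K) (j := k) ℰp) j U) (emb (blockOf x)) x) →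
            (∀ j, K - J ≤ j → ∀ y, g j y = 1) →
            (∀ j, j < K - J → ∀ y : Site (F.P K) (j + 1), g j (emb y) = g (j + 1) y) →
            (∀ X : GaugeField (F.P K) 0 SU2, ∀ j, j ≤ K - J →
              Averaging.iter (fun k => blockAvg (P := F.P K) (j := k) ℰp) j (GaugeField.gaugeAct (g 0) X) =
                GaugeField.gaugeAct (g j) (Averaging.iter (fun k => blockAvg (P := F.P K) (j := k) ℰp) j X)) →
            (∀ j, j < K - J → ∀ x,
              axialT (GaugeField.gaugeAct (g j) (Averaging.iter (fun k => blockAvg (P := F.P K) (j := k) ℰp) j U)) (emb (blockOf x)) x =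
                axialT (lift j (GaugeField.gaugeAct (g (j + 1)) (Averaging.iter (fun k => blockAvg (P := F.P K) (j := k) ℰp) (j + 1) U)))
                  (emb (blockOf x)) x) →
            (∀ j, j < K - J →
              (blockAvg (P := F.P K) (j := j) ℰp).avg (GaugeField.gaugeAct (g j) (Averaging.iter (fun k => blockAvg (P := F.P K) (j := k) ℰp) j U)) =
                GaugeField.gaugeAct (g (j + 1)) (Averaging.iter (fun k => blockAvg (P := F.P K) (j := k) ℰp) (j + 1) U)) →
            (∀ j, j < K - J → ∀ x, g₀ j x =
              (axialT (lift j (GaugeField.gaugeAct (g₀ (j + 1)) (Averaging.iter (fun k => blockAvg (P := F.P K) (j := k) ℰp) (j + 1) U₀)))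
                  (emb (blockOf x)) x)⁻¹ *
                g₀ (j + 1) (blockOf x) * axialT (Averaging.iter (fun k => blockAvg (P := F.P K) (j := k) ℰp) j U₀) (emb (blockOf x)) x) →
            (∀ j, K - J ≤ j → ∀ y, g₀ j y = 1) →
            (∀ j, j < K - J → ∀ y : Site (F.P K) (j + 1), g₀ j (emb y) = g₀ (j + 1) y) →
            (∀ X : GaugeField (F.P K) 0 SU2, ∀ j, j ≤ K - J →
              Averaging.iter (fun k => blockAvg (P := F.P K) (j := k) ℰp) j (GaugeField.gaugeAct (g₀ 0) X) =
                GaugeField.gaugeAct (g₀ j) (Averaging.iter (fun k => blockAvg (P := F.P K) (j := k) ℰp) j X)) →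
            (∀ j, j < K - J → ∀ x,
              axialT (GaugeField.gaugeAct (g₀ j) (Averaging.iter (fun k => blockAvg (P := F.P K) (j := k) ℰp) j U₀)) (emb (blockOf x)) x =
                axialT (lift j (GaugeField.gaugeAct (g₀ (j + 1)) (Averaging.iter (fun k => blockAvg (P := F.P K) (j := k) ℰp) (j + 1) U₀)))
                  (emb (blockOf x)) x) →
            (∀ j, j < K - J →
              (blockAvg (P := F.P K) (j := j) ℰp).avg (GaugeField.gaugeAct (g₀ j) (Averaging.iter (fun k => blockAvg (P := F.P K) (j := k) ℰp) j U₀)) =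
                GaugeField.gaugeAct (g₀ (j + 1)) (Averaging.iter (fun k => blockAvg (P := F.P K) (j := k) ℰp) (j + 1) U₀)) →
            ∃ (r e : ℕ → ℝ) (W : ℕ → ℕ → ℝ), (∀ j, 0 ≤ r j) ∧ (∀ j, 0 ≤ e j) ∧ (∀ j u, 0 ≤ W j u) ∧ ∑ j ∈ range (K - J), (r j + e j) ≤ E ∧
              Real.exp E * ∑ j ∈ range (K - J), ∑ u ∈ range (j + 1), Real.sqrt (F.L : ℝ) ^ (j - u) * W j u ≤ 1 / 2 ∧
              ∀ j, j < K - J →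
                √(∑ b, ‖logVec (su2Quat (GaugeField.gaugeAct (g (j + 1)) (Averaging.iter (fun k => blockAvg (P := F.P K) (j := k) ℰp) (j + 1) U) b)) -
                      logVec (su2Quat (GaugeField.gaugeAct (g₀ (j + 1)) (Averaging.iter (fun k => blockAvg (P := F.P K) (j := k) ℰp) (j + 1) U₀) b))‖ ^ 2) ≤
                  (1 + r j) * √(∑ b, dist1 (GaugeField.gaugeAct (g (j + 1)) (Averaging.iter (fun k => blockAvg (P := F.P K) (j := k) ℰp) (j + 1) U) b *
                    (GaugeField.gaugeAct (g₀ (j + 1)) (Averaging.iter (fun k => blockAvg (P := F.P K) (j := k) ℰp) (j + 1) U₀) b)⁻¹) ^ 2) ∧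
                √(∑ b, dist1 (GaugeField.gaugeAct (g j) (Averaging.iter (fun k => blockAvg (P := F.P K) (j := k) ℰp) j U) b *
                      (lift j (GaugeField.gaugeAct (g (j + 1)) (Averaging.iter (fun k => blockAvg (P := F.P K) (j := k) ℰp) (j + 1) U)) b)⁻¹ *
                    (GaugeField.gaugeAct (g₀ j) (Averaging.iter (fun k => blockAvg (P := F.P K) (j := k) ℰp) j U₀) b *
                      (lift j (GaugeField.gaugeAct (g₀ (j + 1)) (Averaging.iter (fun k => blockAvg (P := F.P K) (j := k) ℰp) (j + 1) U₀)) b)⁻¹)⁻¹) ^ 2) ≤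
                  Real.sqrt (F.L : ℝ) * e j * √(∑ b, dist1 (GaugeField.gaugeAct (g (j + 1)) (Averaging.iter (fun k => blockAvg (P := F.P K) (j := k) ℰp) (j + 1) U) b *
                    (GaugeField.gaugeAct (g₀ (j + 1)) (Averaging.iter (fun k => blockAvg (P := F.P K) (j := k) ℰp) (j + 1) U₀) b)⁻¹) ^ 2) +
                    (C * Real.sqrt (F.L : ℝ) ^ j *
                      √(∑ p, dist1 ((GaugeField.plaqHol (GaugeField.gaugeAct (g₀ 0) U₀) p)⁻¹ * GaugeField.plaqHol (GaugeField.gaugeAct (g 0) U) p) ^ 2) +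
                     ∑ u ∈ range (j + 1), W j u * √(∑ b, dist1 (GaugeField.gaugeAct (g u) (Averaging.iter (fun k => blockAvg (P := F.P K) (j := k) ℰp) u U) b *
                        (GaugeField.gaugeAct (g₀ u) (Averaging.iter (fun k => blockAvg (P := F.P K) (j := k) ℰp) u U₀) b)⁻¹) ^ 2)) := by
  intro L
  obtain ⟨c₀K, hc₀K, hc₀K1, HK⟩ := hKEY L
  obtain ⟨c₀F, hc₀F, -, HF⟩ := hFLAP L
  refine ⟨min c₀K c₀F, lt_min hc₀K hc₀F, (min_le_left _ _).trans hc₀K1, fun cw hcw hcwle => ?_⟩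
  obtain ⟨pSK, HK⟩ := HK cw hcw (hcwle.trans (min_le_left _ _))
  obtain ⟨pSF, HF⟩ := HF cw hcw (hcwle.trans (min_le_right _ _))
  refine ⟨max pSK pSF, fun b₀ p₀ hb hpS hp => ?_⟩
  obtain ⟨ε₁K, hε₁K, HK⟩ := HK b₀ p₀ hb ((le_max_left _ _).trans hpS) hp
  obtain ⟨ε₁F, hε₁F, HF⟩ := HF b₀ p₀ hb ((le_max_right _ _).trans hpS) hp
  refine ⟨min ε₁K ε₁F, lt_min hε₁K hε₁F, fun ε₀ hε₀ hε₀le => ?_⟩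
  obtain ⟨X₁, hX₁, HK⟩ := HK ε₀ hε₀ (hε₀le.trans (min_le_left _ _))
  obtain ⟨a₁, a₂, Z, ha₁, ha₂, hZ, HF⟩ := HF ε₀ hε₀ (hε₀le.trans (min_le_right _ _))
  by_cases hL : 1 < L
  swap
  · exact ⟨1, one_pos, 0, 1, one_pos, fun F γ hFL => absurd (hFL ▸ F.hL.2) hL⟩
  obtain ⟨E', hE'0, γc, hγc, HC⟩ := exists_gamma_chartLetter_128 L hL b₀ p₀ hb hp
  obtain ⟨Es, hEs0, γs, hγs, HS⟩ := exists_gamma_supBudget_128 L hL b₀ p₀ hb hp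
  have hL' : (1 : ℝ) < L := by exact_mod_cast hL
  have hL0 : (0 : ℝ) < L := by linarith
  have hsq : 0 < Real.sqrt (L : ℝ) := Real.sqrt_pos.2 hL0
  have hX₁0 : 0 ≤ X₁ := zero_le_one.trans hX₁
  -- the constants
  obtain ⟨c, hc⟩ : ∃ x : ℝ, x = (((L : ℝ)⁻¹) ^ 2) ^ 2 * (L : ℝ) ^ 3 := ⟨_, rfl⟩
  have hc0 : 0 ≤ c := by rw [hc]; positivity
  obtain ⟨C_F, hCF⟩ : ∃ x : ℝ, x = 2 * √c := ⟨_, rfl⟩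
  have hCF0 : 0 ≤ C_F := by rw [hCF]; positivity
  obtain ⟨φc, hφc⟩ : ∃ x : ℝ, x = √c * √(768 * (((3 : ℕ) : ℝ) - 1)) := ⟨_, rfl⟩
  have hφc0 : 0 ≤ φc := by rw [hφc]; positivity
  obtain ⟨E_e, hEe⟩ : ∃ x : ℝ, x = (a₂ * C_F * X₁ * 1 + a₂ * (φc * (Es + Es)) * (1 + E')) / Real.sqrt L + Z * (1 + E') := ⟨_, rfl⟩
  obtain ⟨E, hE⟩ : ∃ x : ℝ, x = E' + E_e := ⟨_, rfl⟩
  obtain ⟨C, hC⟩ : ∃ x : ℝ, x = X₁ * (a₁ + a₂ * C_F * Real.sqrt L) := ⟨_, rfl⟩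
  have hCpos : 0 < C := by
    rw [hC]; exact mul_pos (by linarith) (by positivity)
  obtain ⟨κ, hκ⟩ : ∃ x : ℝ, x = (a₁ * X₁ / Real.sqrt L + a₂ * C_F * X₁) + (a₁ * X₁ / L + a₂ * C_F * X₁ / Real.sqrt L) + 1 := ⟨_, rfl⟩
  have hκ1 : 1 ≤ κ := by
    have h1 : 0 ≤ a₁ * X₁ / Real.sqrt L + a₂ * C_F * X₁ := by positivity
    have h2 : 0 ≤ a₁ * X₁ / L + a₂ * C_F * X₁ / Real.sqrt L := by positivity
    rw [hκ]; linarith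
  have hκ0 : 0 < κ := by linarith
  obtain ⟨δ, hδ⟩ : ∃ x : ℝ, x = min 1 (1 / (2 * Real.exp E * κ)) := ⟨_, rfl⟩
  have hδ0 : 0 < δ := by rw [hδ]; exact lt_min one_pos (by positivity)
  have hδ1 : δ ≤ 1 := by rw [hδ]; exact min_le_left _ _
  have hδκ : Real.exp E * κ * δ ≤ 1 / 2 := by
    have h2 : δ ≤ 1 / (2 * Real.exp E * κ) := by rw [hδ]; exact min_le_right _ _
    have hpos : 0 < 2 * Real.exp E * κ := by positivity
    calc Real.exp E * κ * δ ≤ Real.exp E * κ * (1 / (2 * Real.exp E * κ)) := mul_le_mul_of_nonneg_left h2 (by positivity)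
      _ = 1 / 2 := by field_simp
  obtain ⟨γK, hγK, HK⟩ := HK δ hδ0
  obtain ⟨γF, hγF, HF⟩ := HF δ hδ0
  refine ⟨min γK (min γF (min γc γs)), lt_min hγK (lt_min hγF (lt_min hγc hγs)), E, C, hCpos,
    fun F γ hFL hγ hγle J K hJK V hV hG U₀ hU₀ U hU hUg wt lift hw hlift g g₀ h0 h1 h2 h3 h4 h5 h0' h1' h2' h3' h4' h5' => ?_⟩
  subst hFL
  have hγK' : γ ≤ γK := hγle.trans (min_le_left _ _)
  have hγF' : γ ≤ γF := hγle.trans ((min_le_right _ _).trans (min_le_left _ _))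
  have hγc' : γ ≤ γc := hγle.trans ((min_le_right _ _).trans ((min_le_right _ _).trans (min_le_left _ _)))
  have hγs' : γ ≤ γs := hγle.trans ((min_le_right _ _).trans ((min_le_right _ _).trans (min_le_right _ _)))
  -- the two displayed letters at this instance
  obtain ⟨ηA, qd, qU, hqd, hqU, hF1, hηA, hGd, hGu⟩ :=
    HK F γ rfl hγ hγK' J K hJK V hV hG U₀ hU₀ U hU hUg wt lift hw hlift g g₀ h0 h1 h2 h3 h4 h5 h0' h1' h2' h3' h4' h5'
  obtain ⟨η, ζ, hη0, hζ0, hF2, hηδ, hζZ⟩ :=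
    HF F γ rfl hγ hγF' J K hJK V hV hG U₀ hU₀ U hU hUg wt lift hw hlift g g₀ h0 h1 h2 h3 h4 h5 h0' h1' h2' h3' h4' h5'
  -- the internal letters: (L♭) and the two sup profiles, in the guard `1∕128`
  have hVd : ∀ e, ‖logVec (su2Quat (V e))‖ ≤ 1 / 128 := hGx F J V hG
  have hwt : ∀ t, t < K - J → ∀ b e, wt t b e = if e.dir = b.dir ∧ (b.src b.dir - emb e.src b.dir).val < (F.P K).L then
      ∏ ν ∈ Finset.univ.erase b.dir, max 0 (1 - ((rel (emb e.src) b.src ν).natAbs : ℝ) / (F.P K).L) else 0 := fun t _ b e => hw t b e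
  have hVl : ∀ t, t < K - J → ∀ b, lift t (GaugeField.gaugeAct (g (t + 1)) (Averaging.iter (fun k => blockAvg (P := F.P K) (j := k) ℰp) (t + 1) U)) b =
      expPoint (∑ e, wt t b e • ((((F.P K).L : ℕ) : ℝ)⁻¹ •
        logVec (su2Quat (GaugeField.gaugeAct (g (t + 1)) (Averaging.iter (fun k => blockAvg (P := F.P K) (j := k) ℰp) (t + 1) U) e)))) := fun t _ b => hlift t _ b
  have hVl' : ∀ t, t < K - J → ∀ b, lift t (GaugeField.gaugeAct (g₀ (t + 1)) (Averaging.iter (fun k => blockAvg (P := F.P K) (j := k) ℰp) (t + 1) U₀)) b =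
      expPoint (∑ e, wt t b e • ((((F.P K).L : ℕ) : ℝ)⁻¹ •
        logVec (su2Quat (GaugeField.gaugeAct (g₀ (t + 1)) (Averaging.iter (fun k => blockAvg (P := F.P K) (j := k) ℰp) (t + 1) U₀) e)))) := fun t _ b => hlift t _ b
  obtain ⟨r, hr0, hrE, hLflat⟩ := HC F γ rfl hγ hγc' J K hJK V hVd U U₀ hU hUg hU₀.1 hU₀.2.1 wt hwt g g₀
    (fun t => lift t (GaugeField.gaugeAct (g (t + 1)) (Averaging.iter (fun k => blockAvg (P := F.P K) (j := k) ℰp) (t + 1) U)))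
    (fun t => lift t (GaugeField.gaugeAct (g₀ (t + 1)) (Averaging.iter (fun k => blockAvg (P := F.P K) (j := k) ℰp) (t + 1) U₀))) hVl h1 h4 h5 hVl' h1' h4' h5'
  obtain ⟨s₁, hs₁0, hs₁b, hs₁4, hs₁1, -⟩ := HS F γ rfl hγ hγs' J K hJK V hVd U hU hUg g wt
    (fun t => lift t (GaugeField.gaugeAct (g (t + 1)) (Averaging.iter (fun k => blockAvg (P := F.P K) (j := k) ℰp) (t + 1) U))) hwt hVl h1 h4 h5
  obtain ⟨s₂, hs₂0, hs₂b, hs₂4, hs₂1, -⟩ := HS F γ rfl hγ hγs' J K hJK V hVd U₀ hU₀.1 hU₀.2.1 g₀ wt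
    (fun t => lift t (GaugeField.gaugeAct (g₀ (t + 1)) (Averaging.iter (fun k => blockAvg (P := F.P K) (j := k) ℰp) (t + 1) U₀))) hwt hVl' h1' h4' h5'
  have hLF : 1 < (F.L : ℝ) := hL'
  have hPd : (F.P K).d = 3 := rfl
  have hPL : (F.P K).L = F.L := rfl
  -- (R1): the hat lift is `√L`-Lipschitz in chord∕log currency (✓p820752 at `d = 3`)
  have hR1 : ∀ j, j < K - J → ∀ X X' : GaugeField (F.P K) (j + 1) SU2,
      ∑ b, dist1 (lift j X b * (lift j X' b)⁻¹) ^ 2 ≤ (F.L : ℝ) * ∑ e, ‖logVec (su2Quat (X e)) - logVec (su2Quat (X' e))‖ ^ 2 := by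
    intro j hj X X'
    have hj' : j + 1 ≤ (F.P K).m + (F.P K).K := by show j + 1 ≤ F.m + K; omega
    have h := sum_dist1_sq_lift_mul_inv_le hj' (wt j) (hw j) X X' (lift j X) (lift j X') (hlift j X) (hlift j X')
    have hL0' : ((F.P K).L : ℝ) ≠ 0 := (Nat.cast_pos.mpr (F.P K).L_pos).ne'
    rw [hPd, show (((F.P K).L : ℝ)⁻¹) ^ 2 * ((F.P K).L : ℝ) ^ 3 = (F.P K).L by field_simp] at h
    exact h
  -- (F3)-rel at the towers (✓p826241), in the door's shape
  have hF3 : ∀ j, j < K - J →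
      √(∑ q, dist1 ((GaugeField.plaqHol (lift j (GaugeField.gaugeAct (g₀ (j + 1)) (Averaging.iter (fun k => blockAvg (P := F.P K) (j := k) ℰp) (j + 1) U₀))) q)⁻¹ *
                  GaugeField.plaqHol (lift j (GaugeField.gaugeAct (g (j + 1)) (Averaging.iter (fun k => blockAvg (P := F.P K) (j := k) ℰp) (j + 1) U))) q) ^ 2) ≤
        C_F * √(∑ q, dist1 ((GaugeField.plaqHol (GaugeField.gaugeAct (g₀ (j + 1)) (Averaging.iter (fun k => blockAvg (P := F.P K) (j := k) ℰp) (j + 1) U₀)) q)⁻¹ *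
                  GaugeField.plaqHol (GaugeField.gaugeAct (g (j + 1)) (Averaging.iter (fun k => blockAvg (P := F.P K) (j := k) ℰp) (j + 1) U)) q) ^ 2) +
          φc * (s₁ (j + 1) + s₂ (j + 1)) * √(∑ b, ‖logVec (su2Quat (GaugeField.gaugeAct (g (j + 1)) (Averaging.iter (fun k => blockAvg (P := F.P K) (j := k) ℰp) (j + 1) U) b)) -
                logVec (su2Quat (GaugeField.gaugeAct (g₀ (j + 1)) (Averaging.iter (fun k => blockAvg (P := F.P K) (j := k) ℰp) (j + 1) U₀) b))‖ ^ 2) := by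
    intro j hj
    have hj' : j + 1 ≤ (F.P K).m + (F.P K).K := by show j + 1 ≤ F.m + K; omega
    have h := sqrt_sum_plaq_dist1_rel_lift_le hj' (wt j) (hw j) (GaugeField.gaugeAct (g (j + 1)) (Averaging.iter (fun k => blockAvg (P := F.P K) (j := k) ℰp) (j + 1) U)) (GaugeField.gaugeAct (g₀ (j + 1)) (Averaging.iter (fun k => blockAvg (P := F.P K) (j := k) ℰp) (j + 1) U₀))
      (lift j (GaugeField.gaugeAct (g (j + 1)) (Averaging.iter (fun k => blockAvg (P := F.P K) (j := k) ℰp) (j + 1) U))) (lift j (GaugeField.gaugeAct (g₀ (j + 1)) (Averaging.iter (fun k => blockAvg (P := F.P K) (j := k) ℰp) (j + 1) U₀))) (hlift j _) (hlift j _)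
      (hs₁b (j + 1) (by omega)) (hs₂b (j + 1) (by omega)) (hs₁4 (j + 1) (by omega)) (hs₂4 (j + 1) (by omega))
    rw [hPd, hPL] at h
    rw [hCF, hφc, hc]
    exact h
  -- the e-budget
  have hr_le : ∀ j, j ∈ range (K - J) → r j ≤ E' := fun j hj =>
    (Finset.single_le_sum (f := r) (fun i _ => hr0 i) hj).trans hrE
  have hqU_le : ∑ j ∈ range (K - J), qU j ≤ 1 := by
    refine le_trans (Finset.sum_le_sum fun j _ => ?_) (hGu.trans hδ1)
    have := Finset.single_le_sum (f := fun u => (F.L : ℝ) ^ (j - u) * qU u)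
      (fun u _ => mul_nonneg (pow_nonneg hL0.le _) (hqU u)) (Finset.self_mem_range_succ j)
    simpa using this
  have hφ_sum : ∑ j ∈ range (K - J), φc * (s₁ (j + 1) + s₂ (j + 1)) ≤ φc * (Es + Es) := by
    rw [← Finset.mul_sum, Finset.sum_add_distrib]; exact mul_le_mul_of_nonneg_left (add_le_add hs₁1 hs₂1) hφc0
  have he := e_budget_le hsq ha₂ hCF0 hX₁0 hE'0 qU (fun j => φc * (s₁ (j + 1) + s₂ (j + 1))) ζ r
    (fun j => mul_nonneg hφc0 (add_nonneg (hs₁0 _) (hs₂0 _))) hζ0 hr_le hqU_le hφ_sum hζZ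
  rw [← hEe] at he
  -- the W-smallness from the two `δ`-clauses
  have hδκ' : Real.exp E * ((a₁ * X₁ / Real.sqrt (F.L : ℝ) + a₂ * C_F * X₁) + (a₁ * X₁ / (F.L : ℝ) + a₂ * C_F * X₁ / Real.sqrt (F.L : ℝ)) + 1) * δ ≤ 1 / 2 := by
    rw [← hκ]; exact hδκ
  have hsmall := smallness_le (E := E) (by positivity : 0 ≤ a₁ * X₁ / Real.sqrt (F.L : ℝ) + a₂ * C_F * X₁)
    (by positivity : 0 ≤ a₁ * X₁ / (F.L : ℝ) + a₂ * C_F * X₁ / Real.sqrt (F.L : ℝ)) hGd hGu hηδ hδκ'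
  rw [hE] at hsmall
  -- the door
  have key := feedbackLetter_of_feeders F hLF U U₀ lift hR1 g g₀ hX₁0 ha₁.le ha₂ hCF0 ηA r (fun j => φc * (s₁ (j + 1) + s₂ (j + 1))) η ζ qd qU
    hr0 (fun j => mul_nonneg hφc0 (add_nonneg (hs₁0 _) (hs₂0 _))) hη0 hζ0 hqd hqU hrE he hsmall hLflat hF1 hηA hF2 hF3
  rw [hE, hC]
  exact key

end Summit.QuantumFields.YangMills.Theorems.FluctuationComparisonRegPrIntLS2BetaStageFeedersAssembly

end
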